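import Mathlib
import Literature.AlgebraicGeometry.Resolution.NearPointsPointCentreUnique
import Summits.ResolutionOfSingularities.ResolutionOfSingularities.Theorems.RadicialJungCleanModelsCleanProp44NearLineVertex
import HarnessLib

/-!
# Route `RadicialJung`, crux `CleanModels` (stmt-ResolutionOfSingularities-15917), line `Sketch` rev 35, stub 6 `stub_cleanProp44` (X44c):
# THE CORNER POINT OF TWO CLEAN SIDES ON THE EXCEPTIONAL DIVISOR IS UNIQUE (global count: at most one vertex obstruction per pair of sides)

Seat decomp-res-hand-2 g19 (structural hand).  Item (iv) of hand-2 g18's census (`Cruxes/CleanModels/Lines/Sketch-memo-hand2-g18-stubs-5-7.md` §2 (a)):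
the GLOBAL count behind the vertex obstruction of ✓ `cleanPermissibleAt_nearLine_or_vertex_or_cross` — without constructing `E_x ≅ ℙ²`.  For the blowing
up `τ : X' → X` of a point `s` of a regular threefold (`𝔪_s = (c₀, c₁, c₂)`, `J_s = 𝔪_s`), the strict transforms of two coordinate hyperplanes
`V(c_{k₁})`, `V(c_{k₂})` (`k₁ ≠ k₂`) meet the exceptional divisor `E_s` in exactly ONE common point: if both «pass through» `y₁` and through `y₂`
(`(τ^♯ c_k) ≠ 𝔪_s 𝒪_{X',y}`, the negation of the no-passing condition of the dossier), then `y₁ = y₂`.  Mechanism = that of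
✓ `IsBlowup.eq_of_isNear_of_isNear_point` ([CoP1] Lemma 4.3 (3)): all points over `s` lie on ONE family of charts (✓ `IsBlowup.exists_chartFamily`); a side
`c_k` passing through `y = q_j(𝔴)` means `c_k/c_j ∈ 𝔴`, so `j` is the third index and `𝔴 ⊇ 𝔪_s B_j + (c_{k₁}/c_j, c_{k₂}/c_j)`, whose image under the
residue map `ρ : B_j → κ(s)[T_{k₁}, T_{k₂}]` (✓ `exists_chartResidueMap`) is the maximal ideal of the origin; hence both primes equal `ρ⁻¹(T_{k₁}, T_{k₂})`
and equal primes of one chart are equal points.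

* `chartGen_mem_of_side` — chart level: a side through `y = q_j(𝔴)` forces `c_k/c_j ∈ 𝔴`, `k ≠ j`, and `𝔪_s B_j ⊆ 𝔴`.
* `eq_of_twoSides_of_twoSides` — two points over `s` through which the same two sides pass coincide (points given with `τ y_i = s`; the side
  condition is read through `τ^♯_{y_i} ∘ (𝒪_{X,s} ≅ 𝒪_{X,τ y_i})`).
* `eq_of_twoSides_of_twoSides'` — the same for `x'` and `x''` with `τ x'' = τ x'`, the condition at `x'` read through `τ^♯_{x'}` directly.
* Consequence for the (R1ᵐⁱⁿ) prover: over a blown-up clean threefold point there are AT MOST THREE vertex-obstruction points (one per pair of charged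
  sides), and on a given near line at most one (g18: the vertex index `i` with `m_i ∈ 𝔪_x` is determined by the line).

Honest framing: OURS, bookkeeping over the tree's chart-family uniqueness mechanism.  Nothing here proves X44c, any case of `CleanModels`, or resolution of
singularities in characteristic `p`.  Setting only: [cite: CossartPiltant2008, Lemma 4.3 (3), (5)] [cite: StacksProject, Tag 0804] [cite: Kollar2007, §1.4].
-/

noncomputable section

set_option linter.dupNamespace false -- mandated namespace of this single-conjunct summit

open IsLocalRing CategoryTheory AlgebraicGeometry
open Literature.AlgebraicGeometry.Resolution Literature.AlgebraicGeometry.Motives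

namespace Summit.ResolutionOfSingularities.ResolutionOfSingularities.Theorems.RadicialJung.CleanModels

universe u

section Scheme

variable {X X' : Scheme.{u}} {τ : X' ⟶ X} {J : X.IdealSheafData}

/-- The canonical identification `𝒪_{X,x} ≅ 𝒪_{X,x}` along a trivial equality is the identity on elements. [folklore] -/
theorem stalkCongr_hom_apply_of_eq_self {x : X} (h : x = x) (r : X.presheaf.stalk x) :
    (X.presheaf.stalkCongr (.of_eq h)).hom.hom r = r := by
  simp [TopCat.Presheaf.stalkCongr]

set_option maxHeartbeats 800000 in
-- chart-level bookkeeping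
/-- **A clean side through a point of a chart.**  `τ : X' → X`, `y ∈ X'` with `τ y = s`, `c` a regular system of parameters of the regular
`3`-dimensional `𝒪_{X,s}`, `q : Spec B_j → X'` a chart of the blowing up of `(c)` over `Spec B_j → Spec 𝒪_{X,s} → X` computing the local ring at
`𝔴` with `q 𝔴 = y`.  If the side `V(c_k)` passes through `y` (`(τ^♯ c_k) ≠ 𝔪_s 𝒪_{X',y}`), then `c_k/c_j ∈ 𝔴`, `k ≠ j`, and `𝔪_s B_j ⊆ 𝔴`.
[cite: StacksProject, Tag 0804] [cite: CossartPiltant2008, Lemma 4.3 (5)] -/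
theorem chartGen_mem_of_side {s : X} {y : X'} (hy : τ y = s) (c : Fin 3 → X.presheaf.stalk s)
    (hc : Ideal.span (Set.range c) = maximalIdeal (X.presheaf.stalk s)) (j : Fin 3)
    (q : Spec (.of (chartRing c j)) ⟶ X') (hsq : q ≫ τ = Spec.map (CommRingCat.ofHom (chartBase c j)) ≫ X.fromSpecStalk s)
    (w : Spec (.of (chartRing c j))) (hqw : q w = y) [IsIso (q.stalkMap w)] {k : Fin 3}
    (hside : Ideal.span {((τ.stalkMap y).hom.comp (X.presheaf.stalkCongr (.of_eq hy.symm)).hom.hom) (c k)} ≠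
      (maximalIdeal (X.presheaf.stalk s)).map ((τ.stalkMap y).hom.comp (X.presheaf.stalkCongr (.of_eq hy.symm)).hom.hom)) :
    chartGen c j k ∈ w.asIdeal ∧ k ≠ j ∧ (maximalIdeal (X.presheaf.stalk s)).map (chartBase c j) ≤ w.asIdeal := by
  classical
  subst hy
  have hψ : ((τ.stalkMap y).hom.comp (X.presheaf.stalkCongr (.of_eq (rfl : τ y = τ y).symm)).hom.hom) = (τ.stalkMap y).hom :=
    RingHom.ext fun r => by rw [RingHom.comp_apply]; exact congrArg _ (stalkCongr_hom_apply_of_eq_self rfl r)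
  rw [hψ] at hside
  obtain ⟨χ, hχ, hloc, hw⟩ := exists_stalk_ringHom_of_chart τ y (CommRingCat.ofHom (chartBase c j)) q w hqw hsq
  have hχ' : ∀ a, χ (chartBase c j a) = (τ.stalkMap y).hom a := fun a => hχ a
  letI := χ.toAlgebra
  haveI : IsLocalization.AtPrime (X'.presheaf.stalk y) w.asIdeal := hloc
  have hmem : ∀ z : chartRing c j, χ z ∈ maximalIdeal (X'.presheaf.stalk y) ↔ z ∈ w.asIdeal := fun z =>
    IsLocalization.AtPrime.to_map_mem_maximal_iff (X'.presheaf.stalk y) w.asIdeal z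
  have hrel : ∀ i, (τ.stalkMap y).hom (c i) = (τ.stalkMap y).hom (c j) * χ (chartGen c j i) := fun i => by
    rw [← hχ', ← hχ', ← map_mul, reesChartBase_apply_eq_mul_chartGen c j i]
  have hE : Ideal.span {(τ.stalkMap y).hom (c j)} = (maximalIdeal (X.presheaf.stalk (τ y))).map (τ.stalkMap y).hom := by
    rw [← hc]; exact span_singleton_eq_map_span_of_rel _ c j (fun i => χ (chartGen c j i)) hrel
  have hgen : chartGen c j k ∈ w.asIdeal := by
    by_contra hnot
    apply hside
    have hu : IsUnit (χ (chartGen c j k)) := by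
      by_contra hu
      exact hnot ((hmem _).mp ((mem_maximalIdeal _).mpr hu))
    rw [hrel k, Ideal.span_singleton_mul_right_unit hu, hE]
  have hw' : (maximalIdeal (X.presheaf.stalk (τ y))).map (chartBase c j) ≤ w.asIdeal := by
    have hw'' : w.asIdeal.comap (chartBase c j) = maximalIdeal (X.presheaf.stalk (τ y)) := hw
    rw [← hw'']; exact Ideal.map_comap_le
  refine ⟨hgen, ?_, hw'⟩
  rintro rfl
  have h1 : chartGen c k k = 1 :=
    centreChartFrac_self c k (chartBase c k) (chartGen c k) (reesChartBase_apply_eq_mul_chartGen c k) (reesChartBase_mem_nonZeroDivisors _ _)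
  rw [h1] at hgen
  exact w.2.ne_top ((Ideal.eq_top_iff_one _).mpr hgen)

set_option maxHeartbeats 1600000 in
-- chart families, residue map, equal primes
/-- **THE CORNER POINT OF TWO SIDES IS UNIQUE.**  See the module docstring. [cite: CossartPiltant2008, Lemma 4.3 (3), (5)] [cite: StacksProject, Tag 0804]
[cite: Kollar2007, §1.4] -/
theorem eq_of_twoSides_of_twoSides (hτ : IsBlowup τ J) {s : X} (hR : IsRegularLocalRing (X.presheaf.stalk s)) (c : Fin 3 → X.presheaf.stalk s)
    (hc : Ideal.span (Set.range c) = maximalIdeal (X.presheaf.stalk s)) (hd : (maximalIdeal (X.presheaf.stalk s)).spanFinrank = 3)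
    (hcJ : Ideal.span (Set.range c) = stalkIdeal J s) {k₁ k₂ : Fin 3} (hk : k₁ ≠ k₂) {y₁ y₂ : X'} (hy₁ : τ y₁ = s) (hy₂ : τ y₂ = s)
    (h₁₁ : Ideal.span {((τ.stalkMap y₁).hom.comp (X.presheaf.stalkCongr (.of_eq hy₁.symm)).hom.hom) (c k₁)} ≠
      (maximalIdeal (X.presheaf.stalk s)).map ((τ.stalkMap y₁).hom.comp (X.presheaf.stalkCongr (.of_eq hy₁.symm)).hom.hom))
    (h₁₂ : Ideal.span {((τ.stalkMap y₁).hom.comp (X.presheaf.stalkCongr (.of_eq hy₁.symm)).hom.hom) (c k₂)} ≠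
      (maximalIdeal (X.presheaf.stalk s)).map ((τ.stalkMap y₁).hom.comp (X.presheaf.stalkCongr (.of_eq hy₁.symm)).hom.hom))
    (h₂₁ : Ideal.span {((τ.stalkMap y₂).hom.comp (X.presheaf.stalkCongr (.of_eq hy₂.symm)).hom.hom) (c k₁)} ≠
      (maximalIdeal (X.presheaf.stalk s)).map ((τ.stalkMap y₂).hom.comp (X.presheaf.stalkCongr (.of_eq hy₂.symm)).hom.hom))
    (h₂₂ : Ideal.span {((τ.stalkMap y₂).hom.comp (X.presheaf.stalkCongr (.of_eq hy₂.symm)).hom.hom) (c k₂)} ≠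
      (maximalIdeal (X.presheaf.stalk s)).map ((τ.stalkMap y₂).hom.comp (X.presheaf.stalkCongr (.of_eq hy₂.symm)).hom.hom)) :
    y₁ = y₂ := by
  classical
  haveI := hR
  -- one family of charts over `s`
  obtain ⟨q, hqπ, hcov⟩ := hτ.exists_chartFamily s c hcJ
  obtain ⟨j₁, w₁, hqw₁, hiso₁⟩ := hcov y₁ hy₁
  obtain ⟨j₂, w₂, hqw₂, hiso₂⟩ := hcov y₂ hy₂
  haveI := hiso₁
  haveI := hiso₂
  obtain ⟨hg₁₁, hne₁₁, hle₁⟩ := chartGen_mem_of_side hy₁ c hc j₁ (q j₁) (hqπ j₁) w₁ hqw₁ h₁₁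
  obtain ⟨hg₁₂, hne₁₂, -⟩ := chartGen_mem_of_side hy₁ c hc j₁ (q j₁) (hqπ j₁) w₁ hqw₁ h₁₂
  obtain ⟨hg₂₁, hne₂₁, hle₂⟩ := chartGen_mem_of_side hy₂ c hc j₂ (q j₂) (hqπ j₂) w₂ hqw₂ h₂₁
  obtain ⟨hg₂₂, hne₂₂, -⟩ := chartGen_mem_of_side hy₂ c hc j₂ (q j₂) (hqπ j₂) w₂ hqw₂ h₂₂
  -- both points lie in the chart of the third index
  obtain ⟨i, hik₁, hik₂, huniv⟩ := exists_third_fin_three k₁ k₂ hk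
  have hj₁ : j₁ = i := by
    rcases huniv j₁ with h | h | h
    · exact h
    · exact absurd h.symm hne₁₁
    · exact absurd h.symm hne₁₂
  have hj₂ : j₂ = j₁ := by
    rw [hj₁]
    rcases huniv j₂ with h | h | h
    · exact h
    · exact absurd h.symm hne₂₁
    · exact absurd h.symm hne₂₂
  subst hj₂
  -- the residue map of the chart: both primes are the preimage of the origin
  have hcq : IsQuasiRegular c := isQuasiRegular_rsop_comp hd c hc id Function.injective_id
  have hcm : ∀ l, c l ∈ maximalIdeal (X.presheaf.stalk s) := fun l => hc ▸ Ideal.subset_span ⟨l, rfl⟩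
  obtain ⟨ρ, hρsurj, hρker, hρF⟩ :
      ∃ ρ : chartRing c j₂ →+* MvPolynomial {i : Fin 3 // i ≠ j₂} (ResidueField (X.presheaf.stalk s)),
        Function.Surjective ρ ∧ RingHom.ker ρ = (maximalIdeal (X.presheaf.stalk s)).map (chartBase c j₂) ∧
        ∀ F : MvPolynomial (Fin 3) (X.presheaf.stalk s),
          ρ (MvPolynomial.eval₂Hom (chartBase c j₂) (fun i => chartGen c j₂ i) F) =
            MvPolynomial.map (residue (X.presheaf.stalk s)) (dehomogenize j₂ F) :=
    exists_chartResidueMap c j₂ hcq hcm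
  have key : ∀ w : Spec (.of (chartRing c j₂)), chartGen c j₂ k₁ ∈ w.asIdeal → chartGen c j₂ k₂ ∈ w.asIdeal →
      (maximalIdeal (X.presheaf.stalk s)).map (chartBase c j₂) ≤ w.asIdeal →
      w.asIdeal = (Ideal.span (Set.range (MvPolynomial.X : {i : Fin 3 // i ≠ j₂} →
        MvPolynomial {i : Fin 3 // i ≠ j₂} (ResidueField (X.presheaf.stalk s))))).comap ρ := by
    intro w hw₁ hw₂ hwle
    have hker : RingHom.ker ρ ≤ w.asIdeal := hρker.trans_le hwle
    have hcomap : w.asIdeal = (w.asIdeal.map ρ).comap ρ := by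
      rw [Ideal.comap_map_of_surjective ρ hρsurj, ← RingHom.ker_eq_comap_bot, sup_eq_left.mpr hker]
    -- `ρ(𝔴) ⊇ (T_{k₁}, T_{k₂}) = (T_i : i ≠ j)`, a maximal ideal, and `ρ(𝔴) ≠ ⊤`
    have hle : Ideal.span (Set.range (MvPolynomial.X : {i : Fin 3 // i ≠ j₂} →
        MvPolynomial {i : Fin 3 // i ≠ j₂} (ResidueField (X.presheaf.stalk s)))) ≤ w.asIdeal.map ρ := by
      rw [Ideal.span_le]
      rintro _ ⟨⟨l, hl⟩, rfl⟩
      rw [SetLike.mem_coe, ← map_chartGen_of_chartResidueMap c j₂ hρF hl]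
      refine Ideal.mem_map_of_mem _ ?_
      rcases huniv l with h | h | h
      · exact absurd (h.trans hj₁.symm) hl
      · rw [h]; exact hw₁
      · rw [h]; exact hw₂
    have hne : w.asIdeal.map ρ ≠ ⊤ := by
      intro htop
      apply w.2.ne_top
      rw [hcomap, htop, Ideal.comap_top]
    have heq := (isMaximal_span_range_X_origin (k := ResidueField (X.presheaf.stalk s)) j₂).eq_of_le hne hle
    rw [hcomap, ← heq]
  have hw : w₁ = w₂ := PrimeSpectrum.ext ((key w₁ hg₁₁ hg₁₂ hle₁).trans (key w₂ hg₂₁ hg₂₂ hle₂).symm)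
  rw [← hqw₁, ← hqw₂, hw]

/-- **The corner point is unique, for `x'` and `x''` over the same point** (the side condition at `x'` read through `τ^♯_{x'}` directly).
[cite: CossartPiltant2008, Lemma 4.3 (3), (5)] [cite: StacksProject, Tag 0804] -/
theorem eq_of_twoSides_of_twoSides' (hτ : IsBlowup τ J) {x' x'' : X'} (he : τ x'' = τ x')
    (hR : IsRegularLocalRing (X.presheaf.stalk (τ x'))) (c : Fin 3 → X.presheaf.stalk (τ x'))
    (hc : Ideal.span (Set.range c) = maximalIdeal (X.presheaf.stalk (τ x'))) (hd : (maximalIdeal (X.presheaf.stalk (τ x'))).spanFinrank = 3)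
    (hcJ : Ideal.span (Set.range c) = stalkIdeal J (τ x')) {k₁ k₂ : Fin 3} (hk : k₁ ≠ k₂)
    (h₁ : Ideal.span {(τ.stalkMap x').hom (c k₁)} ≠ (maximalIdeal (X.presheaf.stalk (τ x'))).map (τ.stalkMap x').hom)
    (h₂ : Ideal.span {(τ.stalkMap x').hom (c k₂)} ≠ (maximalIdeal (X.presheaf.stalk (τ x'))).map (τ.stalkMap x').hom)
    (h₁' : Ideal.span {((τ.stalkMap x'').hom.comp (X.presheaf.stalkCongr (.of_eq he.symm)).hom.hom) (c k₁)} ≠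
      (maximalIdeal (X.presheaf.stalk (τ x'))).map ((τ.stalkMap x'').hom.comp (X.presheaf.stalkCongr (.of_eq he.symm)).hom.hom))
    (h₂' : Ideal.span {((τ.stalkMap x'').hom.comp (X.presheaf.stalkCongr (.of_eq he.symm)).hom.hom) (c k₂)} ≠
      (maximalIdeal (X.presheaf.stalk (τ x'))).map ((τ.stalkMap x'').hom.comp (X.presheaf.stalkCongr (.of_eq he.symm)).hom.hom)) :
    x'' = x' := by
  have hψ : ((τ.stalkMap x').hom.comp (X.presheaf.stalkCongr (.of_eq (rfl : τ x' = τ x').symm)).hom.hom) = (τ.stalkMap x').hom :=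
    RingHom.ext fun r => by rw [RingHom.comp_apply]; exact congrArg _ (stalkCongr_hom_apply_of_eq_self rfl r)
  refine (eq_of_twoSides_of_twoSides hτ hR c hc hd hcJ hk rfl he ?_ ?_ h₁' h₂').symm
  · rw [hψ]; exact h₁
  · rw [hψ]; exact h₂

end Scheme

end Summit.ResolutionOfSingularities.ResolutionOfSingularities.Theorems.RadicialJung.CleanModels

end
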